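import Mathlib.NumberTheory.PrimeCounting
import Mathlib.Analysis.Asymptotics.Defs
import Literature.NumberTheory.LFunctions.LogIntegral
import Literature.NumberTheory.LFunctions.RiemannXi
import Literature.NumberTheory.LFunctions.DeBruijnNewman
import Literature.NumberTheory.LFunctions.ZetaZeros
import HarnessLib
import HarnessLib.Audit

-- provenance: harness21/H21/H21/Statements/RH/Equivalents.lean @ 7fd1621 (interim HEAD d8f2665); M5 mechanical rewrite
/-!
# RH family — classical equivalents of the Riemann hypothesis

Target statements `rh.S20`, `rh.S26`, `rh.S39`, `rh.S28` of the `rh` family (H21 gap inventory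
`families/rh.json`, 2026-08-12; outline `H21/Outlines/AntSieve.md`, §3 `RHEquivalents`).

## Contents

* **rh.S20** von Koch's criterion `RH ↔ π(x) = li(x) + O(√x log x)` (`von_koch`) and Schoenfeld's
  explicit form `|π(x) − li(x)| < √x log x / (8π)` for `x ≥ 2657` under RH
  (`schoenfeld_explicit`).
* **rh.S26** Li's criterion `RH ↔ λ_n ≥ 0` for all `n ≥ 1` (`li_criterion`) and the
  Bombieri–Lagarias zero-sum formula `λ_n = ∑_ρ (1 − (1 − 1/ρ)^n)` (`keiperLiCoeff_eq_zero_sum`).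
* **rh.S39** the Jensen–Pólya criterion (`JensenPolyaCriterion` — a registered OPEN STATEMENT,
  equivalent to RH by `polya_jensen` / `polya_jensen_holds`) and the theorems of
  Griffin–Ono–Rolen–Zagier (`gorz_eventually`, `gorz_le_eight`).
* **rh.S28** the de Bruijn–Newman constant: `Λ ≥ 0` (Rodgers–Tao, `rodgers_tao`), `Λ ≤ 0.2`
  (Platt–Trudgian, `platt_trudgian`), `RH ↔ Λ = 0`
  (`riemannHypothesis_iff_hasOnlyRealZeros_deBruijnH_zero`,
  `riemannHypothesis_iff_deBruijnNewmanConst_eq_zero`).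

## Mathlib and prelude

Mathlib supplies `RiemannHypothesis`, `riemannZeta`, `Nat.primeCounting`, `Asymptotics.IsBigO`,
`Polynomial.Splits`; it has no `li`, `ξ`, Keiper–Li coefficients, Jensen polynomials or `H_t`
(searched `logIntegral`, `riemannXi`, `Jensen`, `deBruijn`, `Newman`, `vonKoch`). Those come from
the H21 prelude: `Literature.NumberTheory.LFunctions.logIntegral`, `Literature.NumberTheory.LFunctions.keiperLiCoeff`, `Literature.NumberTheory.LFunctions.xiTaylorCoeff`, `Literature.NumberTheory.LFunctions.jensenPoly`,
`Literature.NumberTheory.LFunctions.deBruijnH`, `Literature.NumberTheory.LFunctions.HasOnlyRealZeros`, `Literature.NumberTheory.LFunctions.deBruijnNewmanConst`, `Literature.NumberTheory.LFunctions.riemannZetaZeroOrder`.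

## Design choices

* `π(x)` for real `x` is `Nat.primeCounting ⌊x⌋₊`, as in `Statements/RH/Wave0`.
* (Outline finding 5.) All primary `rh.S28` statements are `sInf`-free `∀ t`-statements about
  `HasOnlyRealZeros (deBruijnH t)`; the `sInf` forms (`0 ≤ Λ`, `Λ ≤ 1/5`, `RH ↔ Λ = 0`) are
  *derived corollaries*, proved here from the `sInf`-free theorems and the prelude lemmas
  `hasOnlyRealZeros_deBruijnH_one_half`, `bddBelow_setOf_hasOnlyRealZeros`,
  `deBruijnNewmanConst_le_iff`, plus Newman's closedness lemma
  `hasOnlyRealZeros_deBruijnH_iff_deBruijnNewmanConst_le` recorded here.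
* The Bombieri–Lagarias sum over zeros is only conditionally convergent; it is stated as the
  `T → ∞` limit of the finite sums over `0 < |Im ρ| ≤ T` (the `*`-summation of Bombieri–Lagarias
  1999, eq. (1.2)), with multiplicities `riemannZetaZeroOrder`.
* This file lives in `namespace Literature.RH` (like `Statements/RH/Wave0`), so
  `Literature.RH.riemannHypothesis_iff_hasOnlyRealZeros_deBruijnH_zero` (carrying the id) does not clash
  with the prelude theorem `Literature.NumberTheory.LFunctions.riemannHypothesis_iff_hasOnlyRealZeros_deBruijnH_zero` proving it.
* `JensenPolyaCriterion` is a registered OPEN STATEMENT, not named-fact debt (verdict clean-up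
  2026-08-15, re-verified: GORZ 2019 §1 poses the hyperbolicity of all `J^{d,n}_γ` as the
  RH-equivalent open condition, and the tree proves the equivalence sorry-free,
  `polya_jensen_holds : RiemannHypothesis ↔ JensenPolyaCriterion` in `JensenPolyaProofs.lean`, so
  `JensenPolyaCriterion_holds` would be a proof of RH). Its docstring begins `OPEN CONJECTURE —`
  with the citation of where it is posed and carries `[status: open]` (CONVENTIONS §4); it keeps
  the `@[conjecture]` tag and its NAME (users in four tree files, listed in the docstring).

## References

* H. von Koch, *Sur la distribution des nombres premiers*, Acta Math. 24 (1901).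
* L. Schoenfeld, *Sharper bounds for the Chebyshev functions θ(x) and ψ(x). II*,
  Math. Comp. 30 (1976), Cor. 1 (eq. (6.18)).
* X.-J. Li, *The positivity of a sequence of numbers and the Riemann hypothesis*,
  J. Number Theory 65 (1997), Thm. 1.
* E. Bombieri, J. C. Lagarias, *Complements to Li's criterion for the Riemann hypothesis*,
  J. Number Theory 77 (1999), Thm. 1, Cor. 1, eq. (1.2)–(1.3).
* G. Pólya, *Über die algebraisch-funktionentheoretischen Untersuchungen von J. L. W. V. Jensen*,
  Kgl. Danske Vid. Sel. Math.-Fys. Medd. 7 (1927), 3–33 [Polya1927] (the equivalence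
  `RH ↔ JensenPolyaCriterion`; as stated in GORZ 2019, §1).
* M. Griffin, K. Ono, L. Rolen, D. Zagier, *Jensen polynomials for the Riemann zeta function and
  other sequences*, PNAS 116 (2019), Thms. 1–2 (GORZ).
* B. Rodgers, T. Tao, *The de Bruijn–Newman constant is non-negative*, Forum Math. Pi 8 (2020),
  Thm. 1.
* D. Platt, T. Trudgian, *The Riemann hypothesis is true up to `3 · 10^{12}`*, Bull. LMS 53
  (2021), Cor. 2; Polymath 15, Res. Math. Sci. 6 (2019).
* C. M. Newman, *Fourier transforms with only real zeros*, Proc. AMS 61 (1976), Thm. 3.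
-/

noncomputable section

open Complex Filter Asymptotics Polynomial
open scoped Real Topology

namespace Literature.NumberTheory.LFunctions

/-! ## rh.S20 — von Koch and Schoenfeld -/

/-! ## rh.S26 — Li's criterion -/

/-- The symmetric box of non-trivial zeros `ρ` of `ζ` with `0 ≤ Re ρ ≤ 1` and `0 < |Im ρ| ≤ T`
(each listed once), over which the Bombieri–Lagarias `*`-sum is taken (Bombieri–Lagarias 1999,
eq. (1.2)). It is `zetaZeroBox 0 T` together with its complex conjugate, hence finite
(`liZeroBox_finite`); the closed conditions on `Re ρ` add no zeros (`ζ ≠ 0` on `Re s ∈ {0, 1}`). [cite: BombieriLagarias1999, eq. (1.2] -/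
def liZeroBox (T : ℝ) : Set ℂ :=
  {ρ | riemannZeta ρ = 0 ∧ 0 ≤ ρ.re ∧ ρ.re ≤ 1 ∧ 0 < |ρ.im| ∧ |ρ.im| ≤ T}

/-- The symmetric box `liZeroBox T` is finite (it lies in the compact rectangle
`[0, 1] × [−T, T]`, and the zeros of `ζ` are discrete: `IsCompact.inter_riemannZetaZeros_finite`). [folklore] -/
theorem liZeroBox_finite (T : ℝ) : (liZeroBox T).Finite := by
  refine ((isCompact_Icc (a := (0 : ℝ)) (b := 1)).reProdIm
    (isCompact_Icc (a := -T) (b := T))).inter_riemannZetaZeros_finite.subset ?_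
  rintro ρ ⟨h0, h1, h2, h3, h4⟩
  exact ⟨Complex.mem_reProdIm.2 ⟨⟨h1, h2⟩, abs_le.1 h4⟩, h0⟩

/-- **rh.S26** (Bombieri–Lagarias zero-sum formula for the Keiper–Li coefficients;
Bombieri–Lagarias, J. Number Theory 77 (1999), Thm. 1 and eq. (1.2)–(1.3); Li 1997, eq. (1.4)).
For `n ≥ 1`, `λ_n = ∑*_ρ (1 − (1 − 1/ρ)ⁿ)`, the sum running over the non-trivial zeros `ρ` of `ζ`
counted with multiplicity and understood as `lim_{T → ∞} ∑_{|Im ρ| ≤ T}`. [cite: Li1997, eq. (1.4] -/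
def keiperLiCoeff_eq_zero_sum : Prop :=
  ∀ (n : ℕ) (hn : 1 ≤ n),
    Tendsto (fun T : ℝ ↦ ∑ᶠ ρ ∈ liZeroBox T,
        (riemannZetaZeroOrder ρ : ℂ) * (1 - (1 - 1 / ρ) ^ n))
      atTop (𝓝 (keiperLiCoeff n : ℂ))

/-! ## rh.S39 — Jensen polynomials (Pólya, Griffin–Ono–Rolen–Zagier) -/

/-- OPEN CONJECTURE — **the Jensen–Pólya criterion** (hyperbolicity of *all* Jensen
polynomials of `Ξ`), POSED as the open, RH-equivalent condition in Griffin–Ono–Rolen–Zagier,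
*Jensen polynomials for the Riemann zeta function and other sequences*, PNAS 116 (2019), §1
"Introduction and Statement of Results" [cite: GORZPNAS2019, §1] [status: open]: "Pólya proved
that the Riemann Hypothesis (RH) is equivalent to the hyperbolicity of the Jensen polynomials for
the Riemann zeta function `ζ(s)` at its point of symmetry … Thus, the RH is equivalent to the
hyperbolicity of the polynomials `J^{d,n}_γ(X)` for all non-negative integers `d` and `n`
[CV, DL, Polya]. … Due to the difficulty of proving RH, research has focused on establishing
hyperbolicity for all shifts `n` for small `d`" (the equivalence: G. Pólya, *Über die
algebraisch-funktionentheoretischen Untersuchungen von J. L. W. V. Jensen*, Kgl. Danske Vid.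
Sel. Math.-Fys. Medd. 7 (1927) 3–33 [Polya1927]).
Statement: every Jensen polynomial `J^{d,n}_γ(X) = ∑_{j ≤ d} (d choose j) γ(n + j) X^j` of
the Taylor coefficients `γ = xiTaylorCoeff` of `Ξ`
(`(−1 + 4z²) Λ(1/2 + z) = ∑ γ(n) z^{2n} / n!`) is hyperbolic, i.e. splits over `ℝ`
(`Polynomial.Splits`; the zero polynomial counts as hyperbolic). This is the CRITERION
ITSELF, not a theorem of [Polya1927]: the theorem printed there (and in GORZ §1) is the
*equivalence*, vendored as `polya_jensen` (`RHConditionalFacts.lean`) and PROVED in tree,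
sorry-free, as
`Literature.NumberTheory.LFunctions.polya_jensen_holds : RiemannHypothesis ↔ JensenPolyaCriterion`
(`JensenPolyaProofs.lean`). Hence a discharge `JensenPolyaCriterion_holds` would be a proof of
the Riemann hypothesis and there is none to expect: this is a registered OPEN STATEMENT
(CONVENTIONS §4: open conjectures are `def … : Prop`, never asserted as theorems), not
dischargeable named-fact debt (verdict clean-up 2026-08-15); use it only as an explicit
hypothesis `(h : JensenPolyaCriterion)`. Proved cases, in print: `1 ≤ d ≤ 8`, all `n` (GORZ
Thm. 2; tree fact `gorz_le_eight`); every `d ≥ 1`, all sufficiently large `n` (GORZ Thm. 1; tree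
fact `gorz_eventually`); `n = 0`, `d ≤ 2·10^17` (Chasse, quoted in GORZ §1). Name kept (not
renamed `…Conjecture`): users in `JensenPolyaProofs.lean`, `RHConditionalFacts.lean`
(`polya_jensen`), `Literature/Barriers/RiemannHypothesis/JensenPolynomials.lean`
(`jensenPolyaCriterion_iff`) and
`Summits/RiemannHypothesis/RiemannHypothesis/Theses/TotalPositivity.lean`. -/
@[conjecture] def JensenPolyaCriterion : Prop :=
  ∀ d n : ℕ, (jensenPoly xiTaylorCoeff d n).Splits

/-- **rh.S39** (Griffin–Ono–Rolen–Zagier, PNAS 116 (2019), Thm. 1). For every degree `d ≥ 1`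
the Jensen polynomials `J^{d,n}` of the Taylor coefficients of `Ξ` are hyperbolic for all
sufficiently large shifts `n`. [cite: GORZPNAS2019, Thm. 1] -/
def gorz_eventually : Prop :=
  ∀ (d : ℕ) (hd : 1 ≤ d),
    ∃ N : ℕ, ∀ n : ℕ, N ≤ n → (jensenPoly xiTaylorCoeff d n).Splits

/-- **rh.S39** (Griffin–Ono–Rolen–Zagier, PNAS 116 (2019), Thm. 2; `d ≤ 3` due to
Csordas–Norfolk–Varga 1986 and Dimitrov–Lucas 2011). For every degree `1 ≤ d ≤ 8` the Jensen
polynomials `J^{d,n}` of the Taylor coefficients of `Ξ` are hyperbolic for *all* shifts `n`. [cite: CsordasNorfolkVarga1986, and Dimitrov–Lucas 2011] -/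
def gorz_le_eight : Prop :=
  ∀ (d : ℕ) (hd : 1 ≤ d) (hd' : d ≤ 8) (n : ℕ),
    (jensenPoly xiTaylorCoeff d n).Splits

/-! ## rh.S28 — the de Bruijn–Newman constant -/

/-- **rh.S28** (Newman's conjecture `Λ ≥ 0`; Rodgers–Tao, Forum Math. Pi 8 (2020), Thm. 1;
conjectured by Newman, Proc. AMS 61 (1976)). `sInf`-free form: for every `t < 0` the function
`H_t` has a non-real zero. [cite: RodgersTaoFMP2020, Thm. 1] -/
def rodgers_tao : Prop :=
  ∀ t : ℝ, t < 0 → ¬ HasOnlyRealZeros (deBruijnH t)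

/-- **rh.S28** (`Λ ≤ 0.2`; Platt–Trudgian, Bull. LMS 53 (2021), Cor. 2, via Polymath 15,
Res. Math. Sci. 6 (2019), Thm. 1.1 and RH up to height `3 · 10^{12}`). `sInf`-free form: for every
`t > 1/5` the function `H_t` has only real zeros (equivalent to `Λ ≤ 1/5` by de Bruijn's
monotonicity, `deBruijnNewmanConst_le_iff`). [cite: PlattTrudgianBLMS2021, Cor. 2] -/
def platt_trudgian : Prop :=
  ∀ t : ℝ, 1 / 5 < t → HasOnlyRealZeros (deBruijnH t)

/-- Newman's characterisation of `Λ`: `H_t` has only real zeros if and only if `Λ ≤ t`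
(Newman, Proc. AMS 61 (1976), Thm. 3: "`H_λ` has only real zeros when and only when `λ ≥ Λ`").
The direction `→` is `csInf_le` with `bddBelow_setOf_hasOnlyRealZeros`; the direction `←` at the
endpoint `t = Λ` is Hurwitz's theorem applied to `H_{t'} → H_t` (`t' ↓ t`) and de Bruijn's
monotonicity (`deBruijnNewmanConst_le_iff`). [cite: NewmanPAMS1976, Thm. 3] -/
def hasOnlyRealZeros_deBruijnH_iff_deBruijnNewmanConst_le : Prop :=
  ∀ (t : ℝ),
    HasOnlyRealZeros (deBruijnH t) ↔ deBruijnNewmanConst ≤ t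

/-- **rh.S28**, corollary (`Λ ≥ 0`; Rodgers–Tao, Forum Math. Pi 8 (2020), Thm. 1). Derived from
the `sInf`-free `rodgers_tao` and nonemptiness of `{t | H_t has only real zeros}`
(`hasOnlyRealZeros_deBruijnH_one_half`). [folklore] -/
def deBruijnNewmanConst_nonneg : Prop :=
  0 ≤ deBruijnNewmanConst

/- interim proof relied on results that are now named facts (D-0014); demoted to a fact by the M5 import, proof preserved:
:= by
  refine le_csInf ⟨1 / 2, hasOnlyRealZeros_deBruijnH_one_half⟩ fun t ht ↦ ?_
  by_contra h
  exact rodgers_tao t (lt_of_not_ge h) ht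
-/

/-- **rh.S28**, corollary (`Λ ≤ 0.2`; Platt–Trudgian, Bull. LMS 53 (2021), Cor. 2). Derived from
the `sInf`-free `platt_trudgian` via `deBruijnNewmanConst_le_iff`. [folklore] -/
def deBruijnNewmanConst_le : Prop :=
  deBruijnNewmanConst ≤ 1 / 5

/- interim proof relied on results that are now named facts (D-0014); demoted to a fact by the M5 import, proof preserved:
:=
  (deBruijnNewmanConst_le_iff _).2 platt_trudgian
-/

end Literature.NumberTheory.LFunctions
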